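import Summits.ResolutionOfSingularities.ResolutionOfSingularities.Theorems.MarkedTransferCampaignW46MohWindowShadeAnchorStep
import Summits.ResolutionOfSingularities.ResolutionOfSingularities.Theorems.MarkedTransferCampaignW46MohWindowShadeAnchorExit
import Summits.ResolutionOfSingularities.ResolutionOfSingularities.Theorems.MarkedTransferCampaignW46MohWindowShadeFormalBranch
import Summits.ResolutionOfSingularities.ResolutionOfSingularities.Theorems.MarkedTransferCampaignW46IsolatedThread
import Literature.AlgebraicGeometry.Resolution.AlterationsNormalFormBlowupChartsFormal
import Mathlib.RingTheory.MvPowerSeries.Rename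
import Mathlib.Data.Nat.Nth
import HarnessLib

/-!
# [OURS · L1 W4.6 rung (iii-2), ENTRANCE DOOR, assembly] An infinite permissible sequence inside o1's purely inseparable surface window
# regime whose hit thread starts at a POLYNOMIAL anchor is impossible (algebraically closed base field)

Cell `res-hironaka`, LADDER-RESOLUTION rung L (D-0089), slot W4.6 rung (iii); seat res-L1-s46-pv-6 (gen 4). Host route MarkedTransfer,
`--supports stmt-ResolutionOfSingularities-16155 --as helper`; kind proof (no definition).

THE THEOREM (`false_of_hitThread_anchor`). Let `K` be algebraically closed, `r` an infinite §2.1-permissible sequence (res-L1-s46-pv-1's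
`PermissibleRun`) all of whose stages lie in o1's regime `regimeMohWindowSurfaceInsep` (isolated singular locus, surface window germ of
exponent `E.b = p` at every singular point), `t` a HIT THREAD of `r` (res-L1-s46-pv-1's König extraction `PermissibleRun.nonempty_hitThread`:
singular points `y_k`, compatible, blown up infinitely often), and suppose the stalk at `y_0` carries a POLYNOMIAL ANCHOR
`J_{y_0} = (z^p + F₀(x, y))` with `F₀ ∈ K[y₀, y₁]` cleaned, constants = germs of constant sections. Then `False`.

PROOF (the (H2) transport, all bricks kernel theorems of the tree):
1. constants `κ_k : K → 𝒪_{Z_k, y_k}` (germs of `sectionConst`) are compatible with the blow-ups (`stalkMap_germ_sectionConst`) and every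
   `𝒪_{Z_k,y_k}` is residually rational over them (`exists_sub_germ_sectionConst_mem`: closed point, Zariski's lemma, tree
   `exists_sub_germ_sectionConst_mem_maximalIdeal_of_isClosed`);
2. by recursion along the thread, every `y_k` carries an anchor with model state `S_k`: at a hit stage `S_{k+1} = PointBlowup.step p c b S_k`
   at an EQUIMULTIPLE point `b` in the Hauser–Wagner frame (`…AnchorStep.exists_anchor_step`), off the centre `S_{k+1} = S_k`
   (`…AnchorChart.exists_anchor_offCentre`);
3. the states at the hit stages (`Nat.nth`) form an infinite walk of the shade model, in the window at every stage (`…Anchor`: singularity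
   ⇒ `p ≤ ord`, o1's window germ ⇒ `ord < 2p`), cleaned start;
4. this seat's gen-3 theorem `MohWindowShadeFormalBranch.exists_coordinate_or_digit_curve_of_walk` gives a stage whose residual polynomial is
   `y_l^p · W` or `(y_i − ψ(y_j))^p · W` in `K⟦y⟧`;
5. renamed into `K⟦X₀, X₁, X₂⟧` (Mathlib `MvPowerSeries.rename`) this is a formal `p`-fold factor of the anchor polynomial, so by
   `…AnchorExit.not_regimeMohWindowSurfaceInsep_of_anchor_pfold_factor` (Cohen coordinates + res-D-pv-050's exit door p514487) that stage is
   NOT in the regime — contradiction.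
The rung on the polynomial sub-regime (`…MohWindowShadePolyStatement.lean`) follows in `…MohWindowShadePolyTerminates.lean`.

HONEST FRAMING. Nothing here is a statement of H. Hironaka's manuscript [Hironaka2017] (2017-03-23; Th. 16.6 p.84, Th. 16.13 p.87 — scope
only, under adjudication) and nothing asserts that any statement of it holds; the regime is OURS (res-L1-type-o1). AI-written; AI review is
weaker than expert review. No `sorry`; axioms standard. References: The Stacks Project, Tag 0CY7 (Zariski's lemma), Tag 0804; H. Hauser,
Bull. AMS 47 (2010) §§F–G; D. Kőnig (infinity lemma, via res-L1-s46-pv-1). [StacksProject] [Hauser2010] [folklore]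
-/

noncomputable section

set_option linter.dupNamespace false -- mandated namespace of this single-conjunct summit

open CategoryTheory AlgebraicGeometry TopologicalSpace IsLocalRing MvPolynomial

namespace Summit.ResolutionOfSingularities.ResolutionOfSingularities.Theorems

namespace CampaignW46

namespace MohWindowShadeAnchorWalk

open Literature.AlgebraicGeometry.Resolution
open Literature.AlgebraicGeometry.Resolution.PointBlowup
open Literature.AlgebraicGeometry.Resolution.Hauser2010
open Literature.AlgebraicGeometry.Hironaka2017.S02Preliminaries
open Literature.AlgebraicGeometry.Hironaka2017.Datum
open Scheme.IdealSheafData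

universe u

variable {p : ℕ} [Fact p.Prime] {K : Type u} [Field K] [CharP K p]

/-! ## §1 Constants: germs of constant sections -/

/-- **Constants are compatible with morphisms over `Spec K`.** [folklore] -/
theorem stalkMap_germ_sectionConst {A A' : AmbientDatum p K} (π : A'.Z ⟶ A.Z) (hhom : A'.hom = π ≫ A.hom) (ξ' : A'.Z) (l : K) :
    (π.stalkMap ξ').hom ((A.Z.presheaf.germ ⊤ (π.base ξ') (Opens.mem_top _)).hom (sectionConst A.hom ⊤ l)) =
      (A'.Z.presheaf.germ ⊤ ξ' (Opens.mem_top _)).hom (sectionConst A'.hom ⊤ l) := by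
  have hVU : (⊤ : A'.Z.Opens) ≤ π ⁻¹ᵁ ⊤ := fun x _ => Opens.mem_top _
  rw [stalkMap_germ_appLE π hVU (Opens.mem_top ξ'), appLE_sectionConst, ← hhom]

/-- **The stalk at a closed point is residually rational over the constants** (`K` algebraically closed; Zariski's lemma on an affine
neighbourhood, tree `exists_sub_germ_sectionConst_mem_maximalIdeal_of_isClosed`). [cite: StacksProject, Tag 0CY7] -/
theorem exists_sub_germ_sectionConst_mem [IsAlgClosed K] (A : AmbientDatum p K) {ξ : A.Z} (hξ : IsClosed ({ξ} : Set A.Z))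
    (ρ : A.Z.presheaf.stalk ξ) :
    ∃ l : K, ρ - (A.Z.presheaf.germ ⊤ ξ (Opens.mem_top _)).hom (sectionConst A.hom ⊤ l) ∈ maximalIdeal _ := by
  haveI := A.smooth
  obtain ⟨V, hV, hξV, -⟩ := exists_isAffineOpen_mem_and_subset (X := A.Z) (x := ξ) (U := ⊤) (Opens.mem_top ξ)
  obtain ⟨l, hl⟩ := exists_sub_germ_sectionConst_mem_maximalIdeal_of_isClosed A.hom hV hξV hξ ρ
  refine ⟨l, ?_⟩
  have hgerm : (A.Z.presheaf.germ V ξ hξV).hom (sectionConst A.hom V l) =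
      (A.Z.presheaf.germ ⊤ ξ (Opens.mem_top _)).hom (sectionConst A.hom ⊤ l) := by
    have h1 : sectionConst A.hom V l = (A.Z.presheaf.map (homOfLE (le_top : V ≤ ⊤)).op).hom (sectionConst A.hom ⊤ l) := by
      unfold sectionConst
      rw [RingHom.comp_apply, RingHom.comp_apply, ← CommRingCat.comp_apply (A.hom.appLE ⊤ ⊤ le_top),
        Scheme.Hom.appLE_map]
    rw [h1, ← CommRingCat.comp_apply, TopCat.Presheaf.germ_res]
  rw [← hgerm]
  exact hl

/-! ## §2 Readings at an anchored singular point of the regime -/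

/-- What the regime gives at a singular point: regularity, embedding dimension `3`, closedness, the window germ, `b = p`. [folklore] -/
theorem regime_point {A : AmbientDatum p K} {E : IdealExponent A.Z} (hRg : regimeMohWindowSurfaceInsep (p := p) (K := K) A E)
    {ξ : A.Z} (hξ : ξ ∈ E.sing) :
    IsRegularLocalRing (A.Z.presheaf.stalk ξ) ∧ (maximalIdeal (A.Z.presheaf.stalk ξ)).spanFinrank = 3 ∧
      IsClosed ({ξ} : Set A.Z) ∧ MohWindowSurfaceAt p (A.Z.presheaf.stalk ξ) (stalkIdeal E.J ξ) ∧ E.b = p := by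
  obtain ⟨⟨⟨-, hcl⟩, hwin⟩, hb⟩ := (regimeMohWindowSurfaceInsep_iff A E).mp hRg
  have hw := hwin ξ hξ
  rw [hb] at hw
  exact ⟨hw.1, hw.2.1, hcl hξ, hw, hb⟩

/-- **The window at an anchored singular point**: `p ≤ ord₀ F < 2p` (singularity of the point; o1's window germ read on the anchor through
res-D-pv-050's intrinsic residual order). [folklore] -/
theorem window_of_anchor {A : AmbientDatum p K} {E : IdealExponent A.Z} (hRg : regimeMohWindowSurfaceInsep (p := p) (K := K) A E)
    {ξ : A.Z} (hξ : ξ ∈ E.sing) {x y z : A.Z.presheaf.stalk ξ} (hxyz : Ideal.span {x, y, z} = maximalIdeal _)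
    (κ : K →+* A.Z.presheaf.stalk ξ) (F : MvPolynomial (Fin 2) K)
    (hJ : stalkIdeal E.J ξ = Ideal.span {z ^ p + eval₂ κ (fun l => if l = (0 : Fin 2) then x else y) F}) :
    (p : ℕ∞) ≤ ordZero F ∧ ordZero F < (2 * p : ℕ) := by
  obtain ⟨hR, h3, -, hwin, hb⟩ := regime_point hRg hξ
  haveI := hR
  haveI : CharP (A.Z.presheaf.stalk ξ) p := Literature.AlgebraicGeometry.Hironaka2017.S16Proof.Lem16p11Proof.charP_stalk A (𝟙 A.Z) ξ
  have hx : x ∈ maximalIdeal _ := hxyz ▸ Ideal.subset_span (Set.mem_insert _ _)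
  have hy : y ∈ maximalIdeal _ := hxyz ▸ Ideal.subset_span (Set.mem_insert_of_mem _ (Set.mem_insert _ _))
  have hz : z ∈ maximalIdeal _ := hxyz ▸ Ideal.subset_span (Set.mem_insert_of_mem _ (Set.mem_insert_of_mem _ (Set.mem_singleton _)))
  have hsing : stalkIdeal E.J ξ ≤ maximalIdeal _ ^ p := by
    have := (le_idealOrder_iff E.J ξ E.b).mp hξ
    rwa [hb] at this
  refine ⟨MohWindowShadeAnchor.natCast_le_ordZero_of_span_le_pow₂ hR h3 hxyz κ (j := (0 : Fin 2)) (i := 1) (by decide)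
    (fun l => by fin_cases l <;> simp) (hJ ▸ hsing), ?_⟩
  -- `F ≠ 0`: otherwise `J = (z^p)` would have residual order `⊤`, not the window exponent
  have hF0 : F ≠ 0 := by
    intro hF
    rw [hF, eval₂_zero, add_zero] at hJ
    obtain ⟨hR', h3', x', y', z', hxyz', d, a, hpd, hd2, hunit, hI⟩ := hwin.coeffAt
    have hres := MohWindowSurface.residualOrder_coeff p hR' h3' hxyz' hpd hd2 hunit (z := z')
    rw [← hI, hJ] at hres
    have hle : ((d + 1 : ℕ) : ℕ∞) ≤ residualOrder p (A.Z.presheaf.stalk ξ) (Ideal.span {z ^ p}) :=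
      le_residualOrder hz (le_sup_left)
    rw [hres] at hle
    exact absurd (by exact_mod_cast hle : d + 1 ≤ d) (by omega)
  rw [hJ] at hwin
  exact MohWindowShadeAnchor.ordZero_lt_two_mul_of_mohWindowSurfaceAt₂ hx hy hz κ (j := (0 : Fin 2)) (i := 1) (by decide)
    (fun l => by fin_cases l <;> simp) hF0 hwin

/-! ## §3 One step along a hit thread -/

section Thread

variable [IsAlgClosed K] [DecidableEq K]
variable (κ : ∀ (A : AmbientDatum p K) (ξ : A.Z), K →+* A.Z.presheaf.stalk ξ)
  (hκ : ∀ (A A' : AmbientDatum p K) (π : A'.Z ⟶ A.Z), A'.hom = π ≫ A.hom →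
    ∀ (ξ' : A'.Z) (l : K), (π.stalkMap ξ').hom (κ A (π.base ξ') l) = κ A' ξ' l)
  (hrat : ∀ (A : AmbientDatum p K) (ξ : A.Z), IsClosed ({ξ} : Set A.Z) →
    ∀ ρ : A.Z.presheaf.stalk ξ, ∃ l : K, ρ - κ A ξ l ∈ maximalIdeal _)

include hκ hrat in
/-- **One step along a hit thread.** [OURS · L1 W4.6 rung (iii-2)] NOT a statement of the manuscript. Along a hit thread of a permissible
sequence inside `regimeMohWindowSurfaceInsep`, a polynomial anchor with state `s` at `y_k` yields an anchor at `y_{k+1}` with state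
`PointBlowup.step p c b s` at an EQUIMULTIPLE point `b` in the Hauser–Wagner frame if stage `k` blows up `y_k` (`…AnchorStep.exists_anchor_step`),
and with the same state `s` otherwise (`…AnchorChart.exists_anchor_offCentre`). Constants `κ`: any family compatible with the blow-ups over
which the stalks at closed points are residually rational. [cite: StacksProject, Tag 0804] -/
theorem anchor_succ (r : PermissibleRun p K) (hr : ∀ k, regimeMohWindowSurfaceInsep (p := p) (K := K) (r.A k) (r.E k))
    (t : r.HitThread) (k : ℕ) (s : State (Fin 2) K)
    (hA : ∃ x y z : (r.A k).Z.presheaf.stalk (t.y k), Ideal.span {x, y, z} = maximalIdeal _ ∧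
      stalkIdeal (r.E k).J (t.y k) = Ideal.span {z ^ p + eval₂ (κ (r.A k) (t.y k)) (fun l => if l = (0 : Fin 2) then x else y) s.F}) :
    ∃ (s' : State (Fin 2) K) (c : Fin 2) (b : Fin 2 → K),
      ((r.D k : Set (r.A k).Z) = {t.y k} → s' = step p c b s ∧ b c = 0 ∧ (c = 1 → ∀ l, b l = 0) ∧ IsEquimultiplePoint p c b s) ∧
      ((r.D k : Set (r.A k).Z) ≠ {t.y k} → s' = s) ∧
      ∃ x y z : (r.A (k + 1)).Z.presheaf.stalk (t.y (k + 1)), Ideal.span {x, y, z} = maximalIdeal _ ∧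
        stalkIdeal (r.E (k + 1)).J (t.y (k + 1)) =
          Ideal.span {z ^ p + eval₂ (κ (r.A (k + 1)) (t.y (k + 1))) (fun l => if l = (0 : Fin 2) then x else y) s'.F} := by
  classical
  -- data at stage `k`, moved to the point `π (y (k+1))`
  have hc := t.compat k
  have hmem : (r.π k).base (t.y (k + 1)) ∈ (r.E k).sing := by rw [hc]; exact t.mem k
  obtain ⟨hR, h3, hcl, -, hb⟩ := regime_point (hr k) hmem
  haveI := hR
  obtain ⟨hR', h3', hcl', -, -⟩ := regime_point (hr (k + 1)) (t.mem (k + 1))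
  have hA' : ∃ x y z : (r.A k).Z.presheaf.stalk ((r.π k).base (t.y (k + 1))), Ideal.span {x, y, z} = maximalIdeal _ ∧
      stalkIdeal (r.E k).J ((r.π k).base (t.y (k + 1))) = Ideal.span {z ^ p +
        eval₂ (κ (r.A k) ((r.π k).base (t.y (k + 1)))) (fun l => if l = (0 : Fin 2) then x else y) s.F} := by
    rw [hc]; exact hA
  obtain ⟨x, y, z, hxyz, hJ⟩ := hA'
  have hwin := window_of_anchor (hr k) hmem hxyz _ s.F hJ
  have hdeg : ∀ d ∈ s.F.support, p ≤ d.degree := fun d hd =>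
    (Literature.Barriers.ResolutionOfSingularities.HauserPerlega.natCast_le_ordZero_iff s.F p).mp hwin.1 d hd
  have hsing' : t.y (k + 1) ∈ ((r.E k).transform (r.π k) (r.D k)).sing := by
    have := t.mem (k + 1); rwa [r.E_succ k] at this
  have hκk : ∀ l, ((r.π k).stalkMap (t.y (k + 1))).hom (κ (r.A k) ((r.π k).base (t.y (k + 1))) l) =
      κ (r.A (k + 1)) (t.y (k + 1)) l := hκ _ _ (r.π k) (r.hom_eq k) _
  have hratk := hrat (r.A (k + 1)) (t.y (k + 1)) hcl'
  by_cases hhit : (r.D k : Set (r.A k).Z) = {t.y k}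
  · -- the thread point is blown up: the model takes a step
    have hD : (r.D k : Set (r.A k).Z) = {(r.π k).base (t.y (k + 1))} := by rw [hc]; exact hhit
    obtain ⟨c, b, x', y', z', hbc, hHW, heq, hspan', hJ'⟩ :=
      MohWindowShadeAnchorStep.exists_anchor_step (r.π k) (r.blowup k) hD hcl hsing' hb h3 hR' _ _ hκk hratk
        (j := (0 : Fin 2)) (i := 1) (by decide) (fun l => by fin_cases l <;> simp) hxyz s hdeg hJ
    refine ⟨step p c b s, c, b, fun _ => ⟨rfl, hbc, hHW, heq⟩, fun h => absurd hhit h, x', y', z', hspan', ?_⟩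
    rw [r.E_succ k]; exact hJ'
  · -- the thread point is not blown up: transport
    obtain ⟨ξ₀, -, -, hDξ₀⟩ := IsPermissibleCentre.exists_eq_singleton_of_isolatedSing (r.permissible k)
      ((regimeMohWindowSurfaceInsep_iff _ _).mp (hr k)).1.1
    have hoff : (r.π k).base (t.y (k + 1)) ∉ (r.D k : Set (r.A k).Z) := by
      rw [hc, hDξ₀, Set.mem_singleton_iff]
      rintro rfl
      exact hhit hDξ₀
    obtain ⟨x', y', z', hspan', hJ'⟩ :=
      MohWindowShadeAnchorChart.exists_anchor_offCentre (E := r.E k) (r.π k) (r.blowup k) hoff _ _ hκk hxyz s hJ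
    refine ⟨s, 0, 0, fun h => absurd h hhit, fun _ => rfl, x', y', z', hspan', ?_⟩
    rw [r.E_succ k]; exact hJ'

/-! ## §4 The theorem -/

include hκ hrat in
/-- **THE ENTRANCE DOOR CLOSES ON THE EXIT DOOR.** [OURS · L1 W4.6 rung (iii-2)] NOT a statement of the manuscript. Over an algebraically
closed field, an infinite §2.1-permissible sequence inside o1's regime `regimeMohWindowSurfaceInsep` with a hit thread whose initial point
carries a CLEANED POLYNOMIAL anchor `J_{y_0} = (z^p + F₀(x, y))` does not exist: the thread carries the shade-model walk (`anchor_succ`),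
the walk is infinite, in the window and equimultiple, so by this seat's gen-3 theorem it meets a formal `p`-fold curve, which res-D-pv-050's
exit door forbids in the regime. [cite: Hauser2010, §F (setting f = x^p + y^r g)] [cite: StacksProject, Tag 0CY7] -/
theorem false_of_hitThread_anchor (r : PermissibleRun p K) (hr : ∀ k, regimeMohWindowSurfaceInsep (p := p) (K := K) (r.A k) (r.E k))
    (t : r.HitThread) (F₀ : MvPolynomial (Fin 2) K) (hclean : deletePthPowers p F₀ = F₀)
    (hA0 : ∃ x y z : (r.A 0).Z.presheaf.stalk (t.y 0), Ideal.span {x, y, z} = maximalIdeal _ ∧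
      stalkIdeal (r.E 0).J (t.y 0) = Ideal.span {z ^ p + eval₂ (κ (r.A 0) (t.y 0)) (fun l => if l = (0 : Fin 2) then x else y) F₀}) :
    False := by
  classical
  -- the anchors along the thread, by recursion
  have G : ∀ (k : ℕ) (P : {s : State (Fin 2) K // ∃ x y z : (r.A k).Z.presheaf.stalk (t.y k),
      Ideal.span {x, y, z} = maximalIdeal _ ∧ stalkIdeal (r.E k).J (t.y k) =
        Ideal.span {z ^ p + eval₂ (κ (r.A k) (t.y k)) (fun l => if l = (0 : Fin 2) then x else y) s.F}}),
      ∃ (Q : {s : State (Fin 2) K // ∃ x y z : (r.A (k + 1)).Z.presheaf.stalk (t.y (k + 1)),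
        Ideal.span {x, y, z} = maximalIdeal _ ∧ stalkIdeal (r.E (k + 1)).J (t.y (k + 1)) =
          Ideal.span {z ^ p + eval₂ (κ (r.A (k + 1)) (t.y (k + 1))) (fun l => if l = (0 : Fin 2) then x else y) s.F}})
        (c : Fin 2) (b : Fin 2 → K),
        ((r.D k : Set (r.A k).Z) = {t.y k} → Q.1 = step p c b P.1 ∧ b c = 0 ∧ (c = 1 → ∀ l, b l = 0) ∧
          IsEquimultiplePoint p c b P.1) ∧
        ((r.D k : Set (r.A k).Z) ≠ {t.y k} → Q.1 = P.1) := by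
    intro k P
    obtain ⟨s', c, b, h1, h2, hA'⟩ := anchor_succ κ hκ hrat r hr t k P.1 P.2
    exact ⟨⟨s', hA'⟩, c, b, h1, h2⟩
  choose next nc nb hnext using G
  let seq : ∀ k, {s : State (Fin 2) K // ∃ x y z : (r.A k).Z.presheaf.stalk (t.y k),
      Ideal.span {x, y, z} = maximalIdeal _ ∧ stalkIdeal (r.E k).J (t.y k) =
        Ideal.span {z ^ p + eval₂ (κ (r.A k) (t.y k)) (fun l => if l = (0 : Fin 2) then x else y) s.F}} :=
    fun k => Nat.rec (motive := fun k => {s : State (Fin 2) K // ∃ x y z : (r.A k).Z.presheaf.stalk (t.y k),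
      Ideal.span {x, y, z} = maximalIdeal _ ∧ stalkIdeal (r.E k).J (t.y k) =
        Ideal.span {z ^ p + eval₂ (κ (r.A k) (t.y k)) (fun l => if l = (0 : Fin 2) then x else y) s.F}})
      ⟨⟨F₀, 0⟩, hA0⟩ (fun k P => next k P) k
  have hseq : ∀ k, seq (k + 1) = next k (seq k) := fun k => rfl
  have hseq0 : (seq 0).1 = ⟨F₀, 0⟩ := rfl
  -- the hit stages
  set P : ℕ → Prop := fun k => (r.D k : Set (r.A k).Z) = {t.y k} with hP
  have hinf : (setOf P).Infinite :=
    Nat.frequently_atTop_iff_infinite.mp (Filter.frequently_atTop.mpr fun a => t.hit a)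
  have hPnth : ∀ n, P (Nat.nth P n) := Nat.nth_mem_of_infinite hinf
  have hgap : ∀ n m, Nat.nth P n < m → m < Nat.nth P (n + 1) → ¬ P m := by
    intro n m h1 h2 hm
    obtain ⟨i, -, hi⟩ := Nat.exists_lt_card_nth_eq hm
    rw [← hi] at h1 h2
    have := (Nat.nth_lt_nth hinf).mp h1
    have := (Nat.nth_lt_nth hinf).mp h2
    omega
  have hgap0 : ∀ m, m < Nat.nth P 0 → ¬ P m := by
    intro m h hm
    obtain ⟨i, -, hi⟩ := Nat.exists_lt_card_nth_eq hm
    rw [← hi] at h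
    have := (Nat.nth_lt_nth hinf).mp h
    omega
  -- the state is constant off the hit stages
  have hstay : ∀ m, ¬ P m → (seq (m + 1)).1 = (seq m).1 := fun m hm => by
    rw [hseq]; exact (hnext m (seq m)).2 hm
  have hconst : ∀ n d, Nat.nth P n + 1 + d ≤ Nat.nth P (n + 1) →
      (seq (Nat.nth P n + 1 + d)).1 = (seq (Nat.nth P n + 1)).1 := by
    intro n d
    induction d with
    | zero => intro _; rfl
    | succ d ih =>
      intro hle
      have h1 : (seq (Nat.nth P n + 1 + d + 1)).1 = (seq (Nat.nth P n + 1 + d)).1 :=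
        hstay _ (hgap n _ (by omega) (by omega))
      rw [← ih (by omega), ← h1]
      rfl
  have hconst0 : ∀ d, d ≤ Nat.nth P 0 → (seq d).1 = (seq 0).1 := by
    intro d
    induction d with
    | zero => intro _; rfl
    | succ d ih =>
      intro hle
      rw [hstay d (hgap0 d (by omega))]
      exact ih (by omega)
  -- the model walk
  set sM : ℕ → State (Fin 2) K := fun n => (seq (Nat.nth P n)).1 with hsM
  set cM : ℕ → Fin 2 := fun n => nc (Nat.nth P n) (seq (Nat.nth P n)) with hcM
  set bM : ℕ → Fin 2 → K := fun n => nb (Nat.nth P n) (seq (Nat.nth P n)) with hbM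
  have hhitrel : ∀ n, (seq (Nat.nth P n + 1)).1 = step p (cM n) (bM n) (sM n) ∧ bM n (cM n) = 0 ∧
      (cM n = 1 → ∀ l, bM n l = 0) ∧ IsEquimultiplePoint p (cM n) (bM n) (sM n) := by
    intro n
    have h := (hnext (Nat.nth P n) (seq (Nat.nth P n))).1 (hPnth n)
    rw [← hseq] at h
    exact h
  have hstepM : ∀ n, sM (n + 1) = step p (cM n) (bM n) (sM n) := by
    intro n
    have hlt : Nat.nth P n < Nat.nth P (n + 1) := (Nat.nth_lt_nth hinf).mpr (Nat.lt_succ_self n)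
    obtain ⟨d, hd⟩ : ∃ d, Nat.nth P (n + 1) = Nat.nth P n + 1 + d := ⟨Nat.nth P (n + 1) - (Nat.nth P n + 1), by omega⟩
    rw [← (hhitrel n).1]
    show (seq (Nat.nth P (n + 1))).1 = _
    rw [hd]
    exact hconst n d (by omega)
  have hwinM : ∀ n, (p : ℕ∞) ≤ ordZero (sM n).F ∧ ordZero (sM n).F < (2 * p : ℕ) := by
    intro n
    obtain ⟨x, y, z, hxyz, hJ⟩ := (seq (Nat.nth P n)).2
    exact window_of_anchor (hr _) (t.mem _) hxyz _ _ hJ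
  have hsM0 : sM 0 = ⟨F₀, 0⟩ := by
    show (seq (Nat.nth P 0)).1 = _
    rw [hconst0 _ le_rfl, hseq0]
  -- the gen-3 termination theorem
  obtain ⟨n, hcurve⟩ := MohWindowShadeFormalBranch.exists_coordinate_or_digit_curve_of_walk p (σ := Fin 2) (j := (0 : Fin 2))
    (i := 1) (by decide) (fun l => by fin_cases l <;> simp) sM cM bM (fun n => (hhitrel n).2.1) (fun n => (hhitrel n).2.2.1)
    hstepM (by rw [hsM0]; exact hclean) (by rw [hsM0]; intro d _; exact zero_le) (fun n => (hhitrel n).2.2.2) hwinM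
  -- the exit at the stage `Nat.nth P n`
  set k := Nat.nth P n with hk
  obtain ⟨x, y, z, hxyz, hJ⟩ := (seq k).2
  obtain ⟨hR, h3, hcl, -, hb⟩ := regime_point (hr k) (t.mem k)
  haveI := hR
  -- the frame renaming `y₀ ↦ X₀`, `y₁ ↦ X₁`
  set e : Fin 2 ↪ Fin 3 := ⟨fun l => if l = (0 : Fin 2) then (0 : Fin 3) else 1,
    MohWindowShadeAnchor.frame_rename_injective (j := (0 : Fin 2)) (i := 1) (by decide) (fun l => by fin_cases l <;> simp)⟩ with he
  have he_apply : ∀ l : Fin 2, e l = if l = 0 then (0 : Fin 3) else 1 := fun l => rfl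
  have hJ3 : stalkIdeal (r.E k).J (t.y k) =
      Ideal.span {z ^ p + eval₂ (κ (r.A k) (t.y k)) ![x, y, z] (MvPolynomial.rename e (sM n).F)} := by
    rw [hJ]
    show _ = Ideal.span {z ^ p + eval₂ (κ (r.A k) (t.y k)) ![x, y, z]
      (MvPolynomial.rename (fun l => if l = (0 : Fin 2) then (0 : Fin 3) else 1) (sM n).F)}
    rw [MohWindowShadeAnchor.eval₂_rename_frame]
  rcases hcurve with ⟨l, W, hF⟩ | ⟨W, hF⟩
  · -- a coordinate `p`-th power `y_l^p · W`
    refine MohWindowShadeAnchorExit.not_regimeMohWindowSurfaceInsep_of_anchor_pfold_factor (r.A k) (r.E k) (t.y k) h3 hxyz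
      (κ (r.A k) (t.y k)) (hrat _ _ hcl) _ hb hJ3 (MvPowerSeries.X (e l)) (MvPolynomial.rename e W : MvPolynomial (Fin 3) K)
      (MvPowerSeries.constantCoeff_X _) ?_ ?_ (hr k)
    · have hl : l = 0 ∨ l = 1 := by fin_cases l <;> simp
      rcases hl with rfl | rfl
      · left; rw [he_apply, if_pos rfl, MvPowerSeries.coeff_index_single_self_X]; exact one_ne_zero
      · right; rw [he_apply, if_neg (by decide), MvPowerSeries.coeff_index_single_self_X]; exact one_ne_zero
    · rw [hF, map_mul, map_pow, MvPolynomial.rename_X, MvPolynomial.coe_mul, MvPolynomial.coe_pow, MvPolynomial.coe_X]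
  · -- the digit branch `(y_1 − ψ(y_0))^p · W`
    have hG : ((MvPolynomial.rename e (sM n).F : MvPolynomial (Fin 3) K) : MvPowerSeries (Fin 3) K) =
        (MvPowerSeries.X 1 - MvPowerSeries.rename e (MohWindowShadeFormalBranch.digitSeries (0 : Fin 2) 1 fun k' => bM (n + k') 1)) ^ p *
          MvPowerSeries.rename e W := by
      rw [← MvPowerSeries.rename_coe, hF, map_mul, map_pow, map_sub, MvPowerSeries.rename_X, he_apply, if_neg (by decide)]
    refine MohWindowShadeAnchorExit.not_regimeMohWindowSurfaceInsep_of_anchor_pfold_factor (r.A k) (r.E k) (t.y k) h3 hxyz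
      (κ (r.A k) (t.y k)) (hrat _ _ hcl) _ hb hJ3 _ _ ?_ ?_ hG (hr k)
    · rw [map_sub, MvPowerSeries.constantCoeff_X, MvPowerSeries.constantCoeff_rename, ← MvPowerSeries.coeff_zero_eq_constantCoeff,
        MohWindowShadeFormalBranch.coeff_digitSeries]
      simp
    · right
      have hemb : Finsupp.embDomain e (Finsupp.single 1 1) = Finsupp.single 1 1 := by
        rw [Finsupp.embDomain_single, he_apply, if_neg (by decide)]
      rw [map_sub, MvPowerSeries.coeff_index_single_self_X, ← hemb, MvPowerSeries.coeff_embDomain_rename,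
        MohWindowShadeFormalBranch.coeff_digitSeries]
      simp

end Thread

end MohWindowShadeAnchorWalk

end CampaignW46

end Summit.ResolutionOfSingularities.ResolutionOfSingularities.Theorems

end
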